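import Mathlib
import Summits.ValiantsHypothesis.ValiantsHypothesis.Theorems.NewtonFramesNewtonTauWeakBlockConvexThree

/-!
# Crux `NewtonTauWeak` (stmt-ValiantsHypothesis-5904), line `slope-ladder`: the FAREY–PARABOLA configuration —
three planar sets of sizes `n, n, n²` with `≥ n^{7/3}/8` points of their Minkowski sum in convex position

Census instrument for STUB 1 (`stub_blockConvexBound`, the `M_r(N)` problem of [BBFKOTT10 §5]) at its first open
instance `r = 4`.  Every `r = 4` configuration is an incidence structure between the sumset `P_1 + P_2` (points) and
the sumset `P_3 + P_4` (translates of the target convex curve); all construction families of the census die at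
`n²`.  This file shows that the POINT side alone is not the obstruction: a two-fold sumset of `n`-sets CAN carry
`n^{1/3}` more than the linear regime against `n²` translates —

* `farey_parabola n R` — the parabola arc `P_1 = {(i, i²)}_{i<n}`, the vertical segment `P_2 = {(0, l)}_{l<n}` and
  the set `Y = {(a/2b, a²/4b² - u/b) : 1 ≤ a, b ≤ R, u < R}` (`#Y ≤ R³`) have EXACTLY `n · F(R)` points of
  `P_1 + P_2 + Y` in convex position, all on the parabola `y = x²` at the abscissae `i + a/(2b)`, where
  `F(R) = #{(a, b) : 1 ≤ a ≤ b ≤ R, gcd(a, b) = 1}` is the Farey count (`≈ 3R²/π²`).  Mechanism: in the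
  coordinates `(x, y - x²)` the set `P_1 + P_2` is the integer grid `[n] × [n]` and the translates of the parabola
  by `-Y` are the lattice lines `a x - b y = -u` of slope `a/b ∈ (0, 1]`, each meeting the grid once in every
  column; distinct reduced slopes give distinct landing abscissae `i + a/(2b)`.
* `eight_mul_fareyCount_ge` — `8 F(R) ≥ R²` (elementary sieve: the non-coprime pairs are `≤ Σ_{d≥2} ⌊R/d⌋² ≤ ¾ R²`).
* `farey_parabola_main m` — with `n = m³`, `R = m²`: sizes `≤ n, n, n²` and `≥ n^{7/3}/8 = m⁷/8` convex points
  (the Eisenbrand–Pach–Rothvoß–Sopher ceiling for these sizes is `O(n^{8/3})`; the Lagrange/linear-regime value is `n²`).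

Consequence for the census (`Cruxes/NewtonTauWeak/CENSUS-stub_blockConvexBound-valwidth-p1.md` v4): the `r = 4`
question `M_4(N) ≫ N²?` (Q0) is localised in the TRANSLATION side — whether the Farey translation set `Y`
(denominators up to `n^{2/3}`) can be replaced by a sumset of two `n`-sets; every lattice attempt to do so is
capped at `O(n²)` by the `1/b`-spacing of the intercepts.  Helper for the crux item (`--supports`); nothing here
bears on `NewtonTauWeak` itself or on `VP ≠ VNP`.
-/

set_option linter.dupNamespace false

namespace Summit.ValiantsHypothesis.ValiantsHypothesis.Theorems.NewtonFramesNewtonTauWeak.BlockConvexFarey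

open scoped BigOperators Pointwise
open Summit.ValiantsHypothesis.ValiantsHypothesis.Theorems.NewtonFramesNewtonTauWeak.BlockConvexThree
  (parabola_convexIndependent)

noncomputable section

/-! ### 1. Arithmetic of reduced fractions -/

/-- Reduced fractions are unique: `a b' = a' b` with `gcd(a,b) = gcd(a',b') = 1`, `b, b' ≥ 1`, forces
`(a, b) = (a', b')`. [folklore] -/
theorem coprime_frac_unique {a b a' b' : ℕ} (hb : 0 < b) (hb' : 0 < b') (hab : Nat.Coprime a b)
    (hab' : Nat.Coprime a' b') (h : a * b' = a' * b) : a = a' ∧ b = b' := by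
  have h1 : b ∣ a * b' := ⟨a', by rw [h, mul_comm]⟩
  have hbb' : b ∣ b' := (Nat.Coprime.symm hab).dvd_of_dvd_mul_left h1
  have h2 : b' ∣ a' * b := ⟨a, by rw [← h, mul_comm]⟩
  have hb'b : b' ∣ b := (Nat.Coprime.symm hab').dvd_of_dvd_mul_left h2
  have hbeq : b = b' := Nat.dvd_antisymm hbb' hb'b
  subst hbeq
  exact ⟨Nat.eq_of_mul_eq_mul_right hb h, rfl⟩

/-- The residue `u := a i (b-1) mod b` satisfies `b ∣ a i + u` (it is `-a i mod b`). [folklore] -/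
theorem dvd_add_residue (a i b : ℕ) (hb : 0 < b) : b ∣ a * i + a * i * (b - 1) % b := by
  have : (a * i + a * i * (b - 1) % b) % b = 0 := by
    rw [Nat.add_mod, Nat.mod_mod, ← Nat.add_mod]
    have : a * i + a * i * (b - 1) = a * i * b := by
      zify [hb]
      ring
    rw [this, Nat.mul_mod_left]
  exact Nat.dvd_of_mod_eq_zero this

/-! ### 2. The configuration -/

/-- **The Farey–parabola configuration.**  For all `n, R`: the parabola arc `P_1 = {(i,i²)}_{i<n}`, the vertical
segment `P_2 = {(0,l)}_{l<n}` and a set `Y` of at most `R³` points admit a convexly independent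
`S ⊆ P_1 + P_2 + Y` with EXACTLY `n · F(R)` points, `F(R) = #{1 ≤ a ≤ b ≤ R : gcd(a,b)=1}`:
`S = {(i + a/2b, (i + a/2b)²)}`, `Y = {(a/2b, a²/4b² - u/b)}`. [this file] -/
theorem farey_parabola (n R : ℕ) :
    ∃ (P₁ P₂ Y S : Finset (Fin 2 → ℝ)),
      P₁.card ≤ n ∧ P₂.card ≤ n ∧ Y.card ≤ R ^ 3 ∧ S ⊆ P₁ + P₂ + Y ∧
        ConvexIndependent ℝ (Subtype.val : ↥(S : Set (Fin 2 → ℝ)) → (Fin 2 → ℝ)) ∧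
          S.card = n * (((Finset.Ioc 0 R) ×ˢ (Finset.Ioc 0 R)).filter
            fun p : ℕ × ℕ => p.1 ≤ p.2 ∧ Nat.Coprime p.1 p.2).card := by
  classical
  -- index set and the four finsets
  set I : Finset (ℕ × ℕ) := ((Finset.Ioc 0 R) ×ˢ (Finset.Ioc 0 R)).filter
      fun p : ℕ × ℕ => p.1 ≤ p.2 ∧ Nat.Coprime p.1 p.2 with hI
  set x : ℕ → ℕ × ℕ → ℝ := fun i p => (i : ℝ) + (p.1 : ℝ) / (2 * (p.2 : ℝ)) with hx
  set pt : ℕ × (ℕ × ℕ) → (Fin 2 → ℝ) := fun q => ![x q.1 q.2, (x q.1 q.2) ^ 2] with hpt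
  set P₁ : Finset (Fin 2 → ℝ) := (Finset.range n).image fun i : ℕ => (![(i : ℝ), (i : ℝ) ^ 2] : Fin 2 → ℝ) with hP₁
  set P₂ : Finset (Fin 2 → ℝ) := (Finset.range n).image fun l : ℕ => (![(0 : ℝ), (l : ℝ)] : Fin 2 → ℝ) with hP₂
  set yv : ℕ × (ℕ × ℕ) → (Fin 2 → ℝ) := fun t =>
      ![(t.1 : ℝ) / (2 * (t.2.1 : ℝ)), (t.1 : ℝ) ^ 2 / (4 * (t.2.1 : ℝ) ^ 2) - (t.2.2 : ℝ) / (t.2.1 : ℝ)] with hyv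
  -- t = (a, (b, u))
  set Y : Finset (Fin 2 → ℝ) :=
      ((Finset.Ioc 0 R) ×ˢ ((Finset.Ioc 0 R) ×ˢ (Finset.range R))).image yv with hY
  set S : Finset (Fin 2 → ℝ) := ((Finset.range n) ×ˢ I).image pt with hS
  refine ⟨P₁, P₂, Y, S, ?_, ?_, ?_, ?_, ?_, ?_⟩
  · exact Finset.card_image_le.trans (by simp)
  · exact Finset.card_image_le.trans (by simp)
  · refine Finset.card_image_le.trans ?_
    simp only [Finset.card_product, Nat.card_Ioc, Finset.card_range, Nat.sub_zero]
    exact le_of_eq (by ring)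
  · -- S ⊆ P₁ + P₂ + Y
    intro s hs
    obtain ⟨⟨i, ⟨a, b⟩⟩, hq, rfl⟩ := Finset.mem_image.1 hs
    simp only [Finset.mem_product, Finset.mem_range, hI, Finset.mem_filter, Finset.mem_Ioc] at hq
    obtain ⟨hi, ⟨⟨ha0, haR⟩, ⟨hb0, hbR⟩⟩, hab, hcop⟩ := hq
    -- the residue u and the row l
    set u : ℕ := a * i * (b - 1) % b with hu
    have hub : u < b := Nat.mod_lt _ hb0
    have hdvd : b ∣ a * i + u := dvd_add_residue a i b hb0
    set l : ℕ := (a * i + u) / b with hl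
    have hlb : l * b = a * i + u := Nat.div_mul_cancel hdvd
    have hln : l < n := by
      have h1 : a * i ≤ b * i := Nat.mul_le_mul_right i hab
      have h2 : l * b < n * b := by
        rw [hlb]
        have : i + 1 ≤ n := hi
        nlinarith
      exact Nat.lt_of_mul_lt_mul_right h2
    have hbR' : (b : ℝ) ≠ 0 := by exact_mod_cast hb0.ne'
    have hlR : (l : ℝ) = ((a : ℝ) * i + u) / b := by
      rw [hl, Nat.cast_div hdvd hbR']
      push_cast
      ring
    -- membership
    have hp1 : (![(i : ℝ), (i : ℝ) ^ 2] : Fin 2 → ℝ) ∈ P₁ :=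
      Finset.mem_image.2 ⟨i, Finset.mem_range.2 hi, rfl⟩
    have hp2 : (![(0 : ℝ), (l : ℝ)] : Fin 2 → ℝ) ∈ P₂ :=
      Finset.mem_image.2 ⟨l, Finset.mem_range.2 hln, rfl⟩
    have hy : yv (a, (b, u)) ∈ Y := by
      refine Finset.mem_image.2 ⟨(a, (b, u)), ?_, rfl⟩
      simp only [Finset.mem_product, Finset.mem_Ioc, Finset.mem_range]
      exact ⟨⟨ha0, haR⟩, ⟨hb0, hbR⟩, lt_of_lt_of_le hub hbR⟩
    have hsum : pt (i, (a, b)) = (![(i : ℝ), (i : ℝ) ^ 2] + ![(0 : ℝ), (l : ℝ)]) + yv (a, (b, u)) := by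
      simp only [hpt, hyv, hx]
      funext k
      fin_cases k
      · simp
      · simp only [Fin.mk_one, Fin.isValue, Matrix.cons_val_one, Pi.add_apply, Matrix.cons_val_fin_one]
        rw [hlR]
        field_simp
        ring
    rw [hsum]
    exact Finset.add_mem_add (Finset.add_mem_add hp1 hp2) hy
  · -- convex independence: all points on the parabola
    refine parabola_convexIndependent _ fun s hs => ?_
    obtain ⟨q, _, rfl⟩ := Finset.mem_image.1 (Finset.mem_coe.1 hs)
    simp [hpt]
  · -- the count: `pt` is injective on `range n × I`
    have hinj : Set.InjOn pt ↑((Finset.range n) ×ˢ I) := by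
      rintro ⟨i, ⟨a, b⟩⟩ hq ⟨i', ⟨a', b'⟩⟩ hq' heq
      simp only [Finset.coe_product, Set.mem_prod, Finset.mem_coe, Finset.mem_range, hI,
        Finset.mem_filter, Finset.mem_product, Finset.mem_Ioc] at hq hq'
      obtain ⟨hi, ⟨⟨ha0, haR⟩, ⟨hb0, hbR⟩⟩, hab, hcop⟩ := hq
      obtain ⟨hi', ⟨⟨ha0', haR'⟩, ⟨hb0', hbR'⟩⟩, hab', hcop'⟩ := hq'
      have h0 : x i (a, b) = x i' (a', b') := by
        have := congr_fun heq 0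
        simpa [hpt] using this
      simp only [hx] at h0
      -- the fractional parts lie in (0, 1/2]
      have hbpos : (0 : ℝ) < b := by exact_mod_cast hb0
      have hbpos' : (0 : ℝ) < b' := by exact_mod_cast hb0'
      have hf1 : (0 : ℝ) < (a : ℝ) / (2 * b) := by
        have : (0 : ℝ) < a := by exact_mod_cast ha0
        positivity
      have hf2 : (a : ℝ) / (2 * b) ≤ 1 / 2 := by
        rw [div_le_iff₀ (by positivity)]
        have : (a : ℝ) ≤ b := by exact_mod_cast hab
        linarith
      have hf1' : (0 : ℝ) < (a' : ℝ) / (2 * b') := by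
        have : (0 : ℝ) < a' := by exact_mod_cast ha0'
        positivity
      have hf2' : (a' : ℝ) / (2 * b') ≤ 1 / 2 := by
        rw [div_le_iff₀ (by positivity)]
        have : (a' : ℝ) ≤ b' := by exact_mod_cast hab'
        linarith
      have hii' : i = i' := by
        have h1 : (i : ℝ) < (i' : ℝ) + 1 := by linarith
        have h2 : (i' : ℝ) < (i : ℝ) + 1 := by linarith
        have h1' : i < i' + 1 := by exact_mod_cast h1
        have h2' : i' < i + 1 := by exact_mod_cast h2
        omega
      subst hii'
      have hfrac : (a : ℝ) * b' = (a' : ℝ) * b := by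
        have : (a : ℝ) / (2 * b) = (a' : ℝ) / (2 * b') := by linarith
        field_simp at this
        linarith
      have hfracN : a * b' = a' * b := by exact_mod_cast hfrac
      obtain ⟨rfl, rfl⟩ := coprime_frac_unique hb0 hb0' hcop hcop' hfracN
      rfl
    rw [hS, Finset.card_image_of_injOn hinj, Finset.card_product, Finset.card_range]

/-! ### 3. Counting reduced fractions: `8 F(R) ≥ R²` -/

/-- `Σ_{d=2}^{R} 1/d² ≤ 3/4 - 1/R` for `R ≥ 2` (keep `d = 2, 3`, telescope the rest). [folklore] -/
theorem sum_inv_sq_le (R : ℕ) (hR : 2 ≤ R) :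
    ∑ d ∈ Finset.Icc 2 R, (1 : ℝ) / (d : ℝ) ^ 2 ≤ 3 / 4 - 1 / (R : ℝ) := by
  induction R, hR using Nat.le_induction with
  | base =>
    rw [show Finset.Icc 2 2 = {2} by rfl, Finset.sum_singleton]
    norm_num
  | succ k hk ih =>
    rw [Finset.sum_Icc_succ_top (by omega)]
    have hk0 : (0 : ℝ) < k := by exact_mod_cast (by omega : 0 < k)
    have hstep : (1 : ℝ) / ((k + 1 : ℕ) : ℝ) ^ 2 ≤ 1 / (k : ℝ) - 1 / ((k + 1 : ℕ) : ℝ) := by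
      push_cast
      rw [div_sub_div _ _ hk0.ne' (by positivity), le_div_iff₀ (by positivity),
        div_mul_eq_mul_div, div_le_iff₀ (by positivity)]
      nlinarith
    linarith

/-- The number of NON-coprime pairs in `[1,R]²` is at most `¾ R²` (union bound over the common divisor
`d ≥ 2`, `⌊R/d⌋²` pairs each, and `Σ_{d≥2} 1/d² ≤ ¾`). [folklore] -/
theorem card_not_coprime_le (R : ℕ) :
    ((((Finset.Ioc 0 R) ×ˢ (Finset.Ioc 0 R)).filter
        fun p : ℕ × ℕ => ¬ Nat.Coprime p.1 p.2).card : ℝ) ≤ 3 / 4 * (R : ℝ) ^ 2 := by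
  classical
  set B := ((Finset.Ioc 0 R) ×ˢ (Finset.Ioc 0 R)).filter fun p : ℕ × ℕ => ¬ Nat.Coprime p.1 p.2 with hB
  set M : ℕ → Finset ℕ := fun d => (Finset.Ioc 0 R).filter fun x => d ∣ x with hM
  have hsub : B ⊆ (Finset.Icc 2 R).biUnion fun d => M d ×ˢ M d := by
    intro p hp
    simp only [hB, Finset.mem_filter, Finset.mem_product, Finset.mem_Ioc] at hp
    obtain ⟨⟨⟨ha0, haR⟩, ⟨hb0, hbR⟩⟩, hncop⟩ := hp
    simp only [Finset.mem_biUnion, Finset.mem_Icc, Finset.mem_product, hM, Finset.mem_filter,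
      Finset.mem_Ioc]
    refine ⟨Nat.gcd p.1 p.2, ⟨?_, ?_⟩, ⟨⟨ha0, haR⟩, Nat.gcd_dvd_left _ _⟩, ⟨⟨hb0, hbR⟩, Nat.gcd_dvd_right _ _⟩⟩
    · have h1 : Nat.gcd p.1 p.2 ≠ 1 := hncop
      have h0 : Nat.gcd p.1 p.2 ≠ 0 := fun h => by
        have := (Nat.gcd_eq_zero_iff.1 h).1; omega
      omega
    · exact (Nat.le_of_dvd ha0 (Nat.gcd_dvd_left _ _)).trans haR
  have hMcard : ∀ d, (M d).card = R / d := fun d => Nat.Ioc_filter_dvd_card_eq_div R d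
  have h1 : (B.card : ℝ) ≤ ∑ d ∈ Finset.Icc 2 R, ((R / d : ℕ) : ℝ) ^ 2 := by
    have := (Finset.card_le_card hsub).trans Finset.card_biUnion_le
    have h' : (B.card : ℝ) ≤ ((∑ d ∈ Finset.Icc 2 R, (M d ×ˢ M d).card : ℕ) : ℝ) := by exact_mod_cast this
    refine h'.trans (le_of_eq ?_)
    push_cast
    refine Finset.sum_congr rfl fun d _ => ?_
    rw [Finset.card_product, hMcard d]
    push_cast
    ring
  have h2 : ∀ d ∈ Finset.Icc 2 R, ((R / d : ℕ) : ℝ) ^ 2 ≤ (R : ℝ) ^ 2 * (1 / (d : ℝ) ^ 2) := by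
    intro d hd
    have hd2 : 2 ≤ d := (Finset.mem_Icc.1 hd).1
    have hdpos : (0 : ℝ) < d := by exact_mod_cast (by omega : 0 < d)
    have hq : ((R / d : ℕ) : ℝ) ≤ (R : ℝ) / d := Nat.cast_div_le
    have hq0 : (0 : ℝ) ≤ ((R / d : ℕ) : ℝ) := Nat.cast_nonneg _
    calc ((R / d : ℕ) : ℝ) ^ 2 ≤ ((R : ℝ) / d) ^ 2 := pow_le_pow_left₀ hq0 hq 2
      _ = (R : ℝ) ^ 2 * (1 / (d : ℝ) ^ 2) := by field_simp
  rcases Nat.lt_or_ge R 2 with hR | hR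
  · -- R ≤ 1: no non-coprime pairs
    have hB0 : B = ∅ := by
      rw [Finset.eq_empty_iff_forall_notMem]
      intro p hp
      simp only [hB, Finset.mem_filter, Finset.mem_product, Finset.mem_Ioc] at hp
      obtain ⟨⟨⟨ha0, haR⟩, ⟨hb0, hbR⟩⟩, hncop⟩ := hp
      have ha1 : p.1 = 1 := by omega
      exact hncop (by rw [ha1]; exact Nat.coprime_one_left _)
    rw [hB0, Finset.card_empty, Nat.cast_zero]
    positivity
  · calc (B.card : ℝ) ≤ ∑ d ∈ Finset.Icc 2 R, ((R / d : ℕ) : ℝ) ^ 2 := h1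
      _ ≤ ∑ d ∈ Finset.Icc 2 R, (R : ℝ) ^ 2 * (1 / (d : ℝ) ^ 2) := Finset.sum_le_sum h2
      _ = (R : ℝ) ^ 2 * ∑ d ∈ Finset.Icc 2 R, 1 / (d : ℝ) ^ 2 := by rw [Finset.mul_sum]
      _ ≤ (R : ℝ) ^ 2 * (3 / 4 - 1 / (R : ℝ)) :=
          mul_le_mul_of_nonneg_left (sum_inv_sq_le R hR) (by positivity)
      _ ≤ 3 / 4 * (R : ℝ) ^ 2 := by
          have : (0 : ℝ) < R := by exact_mod_cast (by omega : 0 < R)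
          have : 0 ≤ 1 / (R : ℝ) := by positivity
          nlinarith

/-- **`8 F(R) ≥ R²`**: at least `R²/8` reduced fractions `a/b` with `1 ≤ a ≤ b ≤ R` (ordered coprime pairs are
`≥ R² - ¾R²`, and swapping maps those with `a > b` injectively to those with `a < b`). [folklore] -/
theorem eight_mul_fareyCount_ge (R : ℕ) :
    (R : ℝ) ^ 2 ≤ 8 * ((((Finset.Ioc 0 R) ×ˢ (Finset.Ioc 0 R)).filter
        fun p : ℕ × ℕ => p.1 ≤ p.2 ∧ Nat.Coprime p.1 p.2).card : ℝ) := by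
  classical
  set Bx := (Finset.Ioc 0 R) ×ˢ (Finset.Ioc 0 R) with hBx
  set F := Bx.filter fun p : ℕ × ℕ => p.1 ≤ p.2 ∧ Nat.Coprime p.1 p.2 with hF
  set C := Bx.filter fun p : ℕ × ℕ => Nat.Coprime p.1 p.2 with hC
  set N := Bx.filter fun p : ℕ × ℕ => ¬ Nat.Coprime p.1 p.2 with hN
  -- C ⊆ F ∪ swap(F-part)
  have hCle : C.card ≤ F.card + F.card := by
    set G := Bx.filter fun p : ℕ × ℕ => p.2 < p.1 ∧ Nat.Coprime p.1 p.2 with hG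
    have hCsub : C ⊆ F ∪ G := by
      intro p hp
      simp only [hC, Finset.mem_filter] at hp
      rcases le_or_gt p.1 p.2 with h | h
      · exact Finset.mem_union_left _ (Finset.mem_filter.2 ⟨hp.1, h, hp.2⟩)
      · exact Finset.mem_union_right _ (Finset.mem_filter.2 ⟨hp.1, h, hp.2⟩)
    have hGF : G.card ≤ F.card := by
      refine Finset.card_le_card_of_injOn Prod.swap (fun p hp => ?_) (fun p _ q _ h => ?_)
      · simp only [hG, hBx, Finset.coe_filter, Finset.mem_product, Finset.mem_Ioc, Set.mem_setOf_eq] at hp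
        simp only [hF, hBx, Finset.coe_filter, Finset.mem_product, Finset.mem_Ioc, Set.mem_setOf_eq,
          Prod.fst_swap, Prod.snd_swap]
        exact ⟨⟨hp.1.2, hp.1.1⟩, le_of_lt hp.2.1, hp.2.2.symm⟩
      · exact Prod.swap_injective h
    exact (Finset.card_le_card hCsub).trans ((Finset.card_union_le _ _).trans (by omega))
  -- #Bx = #C + #N
  have hsplit : Bx.card = C.card + N.card := by
    rw [hC, hN, ← Finset.card_filter_add_card_filter_not (p := fun p : ℕ × ℕ => Nat.Coprime p.1 p.2)]
  have hBxcard : Bx.card = R * R := by simp [hBx]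
  have hNle : (N.card : ℝ) ≤ 3 / 4 * (R : ℝ) ^ 2 := card_not_coprime_le R
  have h1 : ((R * R : ℕ) : ℝ) = (C.card : ℝ) + N.card := by rw [← hBxcard, hsplit]; push_cast; ring
  have h2 : (C.card : ℝ) ≤ F.card + F.card := by exact_mod_cast hCle
  push_cast at h1
  nlinarith

/-! ### 4. The headline: sizes `(n, n, n²)` and `n^{7/3}/8` convex points -/

/-- **`M(n, n, n²) ≥ n^{7/3}/8`.**  For every `m`, with `n = m³`: planar sets `P_1, P_2` of at most `n` points and
`Y` of at most `n² = m⁶` points, and a convexly independent `S ⊆ P_1 + P_2 + Y` with `#S ≥ m⁷/8 = n^{7/3}/8`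
(the Farey–parabola configuration with `R = m²`).  For comparison: the Eisenbrand–Pach–Rothvoß–Sopher bound
for these sizes is `O(n^{8/3})` and the linear-regime / Lagrange value is `n²`. [this file] -/
theorem farey_parabola_main (m : ℕ) :
    ∃ (P₁ P₂ Y S : Finset (Fin 2 → ℝ)),
      P₁.card ≤ m ^ 3 ∧ P₂.card ≤ m ^ 3 ∧ Y.card ≤ m ^ 6 ∧ S ⊆ P₁ + P₂ + Y ∧
        ConvexIndependent ℝ (Subtype.val : ↥(S : Set (Fin 2 → ℝ)) → (Fin 2 → ℝ)) ∧
          ((m : ℝ) ^ 7) / 8 ≤ S.card := by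
  obtain ⟨P₁, P₂, Y, S, h1, h2, h3, h4, h5, h6⟩ := farey_parabola (m ^ 3) (m ^ 2)
  refine ⟨P₁, P₂, Y, S, h1, h2, by simpa [← pow_mul] using h3, h4, h5, ?_⟩
  have hF := eight_mul_fareyCount_ge (m ^ 2)
  rw [h6]
  push_cast
  push_cast at hF
  have hm : (0 : ℝ) ≤ (m : ℝ) ^ 3 := by positivity
  nlinarith

end

end Summit.ValiantsHypothesis.ValiantsHypothesis.Theorems.NewtonFramesNewtonTauWeak.BlockConvexFarey
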